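import Mathlib.Analysis.SpecialFunctions.Pow.Deriv
import Mathlib.Analysis.SpecialFunctions.Pow.Continuity
import Mathlib.Analysis.Calculus.Deriv.Slope
import Summits.KontsevichZagierPeriods.KontsevichZagierPeriods.Theses.TerasomaMultiplication

/-!
# `MultiplicationAccessible` (stmt-KontsevichZagierPeriods-12305), line `shifted-family-prime-sieve`,
stub `cornerFaceLimitThree`: the exceptional-face limit of the Liouville corner Stokes argument, `p = 3`

In the corner blow-up `t_k = 1 - y θ_k` (`θ₀ = 1 - θ₁ - θ₂`) of the cube `(0,1)³`, the `y`-direction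
Newton–Leibniz move of the Liouville rotation flow needs the value of the primitive
`c₂(θ, y, v) = E · y · S_F` on the exceptional face `y = 0`, where, with
`ζ = (t₀ t₁ t₂)^(1/3)` and `a(z) = 3 z^(3x-1) (1-z)^(3s-1)`,

  `E = a(vζ) · y^(3s-1) · (1-ζ)^(-3s) · (θ₀θ₁θ₂)^(s-1) / (3ζ²)`,
  `S_F = θ₀ t₀ (t₁^(1/3) t₂^(2/3)) + θ₁ t₁ (t₂^(1/3) t₀^(2/3)) + θ₂ t₂ (t₀^(1/3) t₁^(2/3))`.

The registered sub-goal `cornerFaceLimitThree` is the statement that, as `y → 0⁺`,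
`E · y · S_F → a(v) · 3^(3s-1) (θ₀θ₁θ₂)^(s-1)` — the Dirichlet density of the target.

Proof. For `0 < y < 1` every `t_k ∈ (0,1)`, so `0 < ζ < 1` and
`y^(3s-1) · (1-ζ)^(-3s) · y = (y/(1-ζ))^(3s)`; hence on `(0,1)` the function equals
`a(vζ) · (y/(1-ζ))^(3s) · (θ₀θ₁θ₂)^(s-1) · S_F / (3ζ²)` (`CornerFace.tendsto_of_parts`). As `y → 0⁺`:
`ζ → 1`, `a(vζ) → a(v)`, `S_F → θ₀ + θ₁ + θ₂ = 1` (continuity), and the key limit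
`y/(1-ζ) → 3` (`CornerFace.tendsto_div_one_sub_geomMean`) because `ζ(0) = 1` and `ζ'(0) = -1/3`
(`HasDerivAt.rpow_const`, `HasDerivAt.tendsto_slope_zero`). No definitions, no notation.

References: M. Kontsevich, D. Zagier, *Periods* (2001), §1.2 (the Stokes / Newton–Leibniz rule);
G. Andrews, R. Askey, R. Roy, *Special Functions* (1999), Thm 1.5.2 (Gauss multiplication) and
§1.8 (Dirichlet/Liouville integrals).
-/

open Filter Topology Real

namespace Summit.KontsevichZagierPeriods.TerasomaMultiplication.MultiplicationAccessible

namespace CornerFace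

/-- **Key limit.** For `a + b + c = 1` the geometric mean `g(y) = ((1-ya)(1-yb)(1-yc))^(1/3)` has
`g(0) = 1`, `g'(0) = -1/3`, hence `y / (1 - g y) → 3` as `y → 0⁺`. [folklore] -/
theorem tendsto_div_one_sub_geomMean (a b c : ℝ) (h : a + b + c = 1) :
    Tendsto (fun y : ℝ => y / (1 - ((1 - y * a) * (1 - y * b) * (1 - y * c)) ^ ((1:ℝ)/3)))
      (𝓝[>] 0) (𝓝 3) := by
  set g : ℝ → ℝ := fun y => ((1 - y * a) * (1 - y * b) * (1 - y * c)) ^ ((1:ℝ)/3) with hg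
  have hder : HasDerivAt g (-(1:ℝ)/3) 0 := by
    have ha : HasDerivAt (fun y : ℝ => 1 - y * a) (-a) 0 := by
      simpa using ((hasDerivAt_id (0:ℝ)).mul_const a).const_sub 1
    have hb : HasDerivAt (fun y : ℝ => 1 - y * b) (-b) 0 := by
      simpa using ((hasDerivAt_id (0:ℝ)).mul_const b).const_sub 1
    have hc : HasDerivAt (fun y : ℝ => 1 - y * c) (-c) 0 := by
      simpa using ((hasDerivAt_id (0:ℝ)).mul_const c).const_sub 1
    have h1 : HasDerivAt (fun y : ℝ => (1 - y * a) * (1 - y * b) * (1 - y * c))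
        (-(a + b + c)) 0 :=
      ((ha.mul hb).mul hc).congr_deriv (by simp only [Pi.mul_apply]; ring)
    have h2 := h1.rpow_const (p := (1:ℝ)/3) (Or.inl (by norm_num))
    refine h2.congr_deriv ?_
    rw [h]; norm_num
  have hg0 : g 0 = 1 := by simp [hg]
  have hsl := hder.tendsto_slope_zero
  rw [hg0] at hsl
  have heq : ∀ y : ℝ, y / (1 - g y) = -(y⁻¹ * (g y - 1))⁻¹ := fun y => by
    rw [mul_inv, inv_inv, ← neg_sub, mul_comm]
    field_simp
  have hlim : Tendsto (fun y : ℝ => -(y⁻¹ * (g y - 1))⁻¹) (𝓝[≠] 0) (𝓝 3) := by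
    have := (hsl.inv₀ (by norm_num : (-(1:ℝ)/3) ≠ 0)).neg
    refine (this.congr fun y => ?_).trans ?_
    · rw [zero_add, smul_eq_mul]
    · norm_num
  show Tendsto (fun y : ℝ => y / (1 - g y)) (𝓝[>] 0) (𝓝 3)
  simp_rw [heq]
  exact hlim.mono_left (nhdsWithin_mono _ fun y hy => ne_of_gt hy)

/-- `1 - y·a → 1` as `y → 0`. -/
theorem tendsto_one_sub_mul (a : ℝ) : Tendsto (fun y : ℝ => 1 - y * a) (𝓝 0) (𝓝 1) := by
  have hc : Continuous (fun y : ℝ => 1 - y * a) := by fun_prop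
  simpa using hc.tendsto 0

/-- `(1 - y·a)^q → 1` as `y → 0`. -/
theorem tendsto_one_sub_mul_rpow (a q : ℝ) :
    Tendsto (fun y : ℝ => (1 - y * a) ^ q) (𝓝 0) (𝓝 1) := by
  simpa using (tendsto_one_sub_mul a).rpow_const (p := q) (Or.inl one_ne_zero)

/-- `(1 - y·a)(1 - y·b)(1 - y·c) → 1` as `y → 0`. -/
theorem tendsto_prod_one_sub_mul (a b c : ℝ) :
    Tendsto (fun y : ℝ => (1 - y * a) * (1 - y * b) * (1 - y * c)) (𝓝 0) (𝓝 1) := by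
  simpa using ((tendsto_one_sub_mul a).mul (tendsto_one_sub_mul b)).mul (tendsto_one_sub_mul c)

/-- The geometric mean `((1 - y·a)(1 - y·b)(1 - y·c))^(1/3) → 1` as `y → 0`. -/
theorem tendsto_geomMean (a b c : ℝ) :
    Tendsto (fun y : ℝ => ((1 - y * a) * (1 - y * b) * (1 - y * c)) ^ ((1:ℝ)/3)) (𝓝 0) (𝓝 1) := by
  simpa using (tendsto_prod_one_sub_mul a b c).rpow_const (p := (1:ℝ)/3) (Or.inl one_ne_zero)

/-- The Dirichlet-density factor `3 (vζ)^p (1 - vζ)^q → 3 v^p (1-v)^q` as `y → 0`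
(`ζ` the geometric mean of `1 - y·a, 1 - y·b, 1 - y·c`; `0 < v < 1`). -/
theorem tendsto_density (a b c v p q : ℝ) (hv0 : 0 < v) (hv1 : v < 1) :
    Tendsto (fun y : ℝ => 3 * (v * ((1 - y * a) * (1 - y * b) * (1 - y * c)) ^ ((1:ℝ)/3)) ^ p *
        (1 - v * ((1 - y * a) * (1 - y * b) * (1 - y * c)) ^ ((1:ℝ)/3)) ^ q) (𝓝 0)
      (𝓝 (3 * v ^ p * (1 - v) ^ q)) := by
  have h1 : Tendsto (fun y : ℝ => v * ((1 - y * a) * (1 - y * b) * (1 - y * c)) ^ ((1:ℝ)/3))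
      (𝓝 0) (𝓝 v) := by
    simpa using (tendsto_geomMean a b c).const_mul v
  have h2 := h1.rpow_const (p := p) (Or.inl hv0.ne')
  have h3 := (h1.const_sub 1).rpow_const (p := q) (Or.inl (sub_pos.2 hv1).ne')
  exact (h2.const_mul 3).mul h3

/-- The Stokes weight `S_F → a + b + c = 1` as `y → 0`. -/
theorem tendsto_weight (a b c : ℝ) (h : a + b + c = 1) :
    Tendsto (fun y : ℝ => a * (1 - y * a) * ((1 - y * b) ^ ((1:ℝ)/3) * (1 - y * c) ^ ((2:ℝ)/3)) +
        b * (1 - y * b) * ((1 - y * c) ^ ((1:ℝ)/3) * (1 - y * a) ^ ((2:ℝ)/3)) +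
        c * (1 - y * c) * ((1 - y * a) ^ ((1:ℝ)/3) * (1 - y * b) ^ ((2:ℝ)/3))) (𝓝 0) (𝓝 1) := by
  have hT : ∀ d e f : ℝ, Tendsto (fun y : ℝ =>
      d * (1 - y * d) * ((1 - y * e) ^ ((1:ℝ)/3) * (1 - y * f) ^ ((2:ℝ)/3))) (𝓝 0) (𝓝 d) := by
    intro d e f
    simpa using ((tendsto_one_sub_mul d).const_mul d).mul
      ((tendsto_one_sub_mul_rpow e ((1:ℝ)/3)).mul (tendsto_one_sub_mul_rpow f ((2:ℝ)/3)))
  have := ((hT a b c).add (hT b c a)).add (hT c a b)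
  rwa [h] at this

/-- For `0 < y < 1` and `0 < t < 1`: `0 < 1 - y·t < 1`. -/
theorem one_sub_mul_mem {y t : ℝ} (hy0 : 0 < y) (hy1 : y < 1) (ht0 : 0 < t) (ht1 : t < 1) :
    0 < 1 - y * t ∧ 1 - y * t < 1 :=
  ⟨sub_pos.2 (mul_lt_one_of_nonneg_of_lt_one_left hy0.le hy1 ht1.le),
    sub_lt_self 1 (mul_pos hy0 ht0)⟩

/-- For `0 < y < 1` and `0 < a, b, c < 1` the geometric mean of `1 - y·a, 1 - y·b, 1 - y·c` lies
in `(0, 1)`. -/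
theorem geomMean_mem {y a b c : ℝ} (hy0 : 0 < y) (hy1 : y < 1) (ha0 : 0 < a) (ha1 : a < 1)
    (hb0 : 0 < b) (hb1 : b < 1) (hc0 : 0 < c) (hc1 : c < 1) :
    0 < ((1 - y * a) * (1 - y * b) * (1 - y * c)) ^ ((1:ℝ)/3) ∧
      ((1 - y * a) * (1 - y * b) * (1 - y * c)) ^ ((1:ℝ)/3) < 1 := by
  obtain ⟨a0, a1⟩ := one_sub_mul_mem hy0 hy1 ha0 ha1
  obtain ⟨b0, b1⟩ := one_sub_mul_mem hy0 hy1 hb0 hb1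
  obtain ⟨c0, c1⟩ := one_sub_mul_mem hy0 hy1 hc0 hc1
  have hP0 : 0 < (1 - y * a) * (1 - y * b) * (1 - y * c) := mul_pos (mul_pos a0 b0) c0
  have hP1 : (1 - y * a) * (1 - y * b) * (1 - y * c) < 1 :=
    mul_lt_one_of_nonneg_of_lt_one_right
      (mul_lt_one_of_nonneg_of_lt_one_right a1.le b0.le b1).le c0.le c1
  exact ⟨rpow_pos_of_pos hP0 _, rpow_lt_one hP0.le hP1 (by norm_num)⟩

/-- **Assembly.** If `y/(1 - ζ y) → 3`, `ζ → 1`, `A → a`, `S → 1` along `y → 0⁺` and `ζ < 1` on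
`(0,1)`, then `A·y^(σ-1)·(1-ζ)^(-σ)·K/(3ζ²)·y·S → a·(3^(σ-1)·K)`: on `(0,1)` the function equals
`A·(y/(1-ζ))^σ·K·S/(3ζ²)` (`Real.div_rpow`, `Real.rpow_add_one`, `Real.rpow_neg`). -/
theorem tendsto_of_parts {ζ A S : ℝ → ℝ} {a K σ : ℝ}
    (hkey : Tendsto (fun y => y / (1 - ζ y)) (𝓝[>] 0) (𝓝 3))
    (hζ1 : Tendsto ζ (𝓝[>] 0) (𝓝 1)) (hA : Tendsto A (𝓝[>] 0) (𝓝 a))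
    (hS : Tendsto S (𝓝[>] 0) (𝓝 1)) (hζb : ∀ y, 0 < y → y < 1 → ζ y < 1) :
    Tendsto (fun y => A y * y ^ (σ - 1) * (1 - ζ y) ^ (-σ) * K / (3 * ζ y ^ 2) * y * S y)
      (𝓝[>] 0) (𝓝 (a * (3 ^ (σ - 1) * K))) := by
  have hpow : Tendsto (fun y => (y / (1 - ζ y)) ^ σ) (𝓝[>] 0) (𝓝 (3 ^ σ)) :=
    hkey.rpow_const (Or.inl three_ne_zero)
  have hG : Tendsto (fun y => A y * (y / (1 - ζ y)) ^ σ * K * S y / (3 * ζ y ^ 2)) (𝓝[>] 0)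
      (𝓝 (a * 3 ^ σ * K * 1 / (3 * 1 ^ 2))) :=
    (((hA.mul hpow).mul_const K).mul hS).div ((hζ1.pow 2).const_mul 3) (by norm_num)
  have hval : a * 3 ^ σ * K * 1 / (3 * 1 ^ 2) = a * (3 ^ (σ - 1) * K) := by
    rw [rpow_sub_one three_ne_zero]; ring
  rw [hval] at hG
  refine hG.congr' ?_
  have hmem : Set.Ioo (0:ℝ) 1 ∈ 𝓝[>] (0:ℝ) := Ioo_mem_nhdsGT one_pos
  filter_upwards [hmem] with y hy
  obtain ⟨hy0, hy1⟩ := hy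
  have hz : 0 < 1 - ζ y := sub_pos.2 (hζb y hy0 hy1)
  have hy3 : y ^ σ = y ^ (σ - 1) * y := by rw [← rpow_add_one hy0.ne', sub_add_cancel]
  rw [div_rpow hy0.le hz.le, hy3, rpow_neg hz.le]
  ring

end CornerFace

open CornerFace in
/-- **Exceptional-face limit of the Liouville corner Stokes argument at `p = 3`** (registered
sub-goal `cornerFaceLimitThree` of line `shifted-family-prime-sieve`). With `t₀ = 1 - y(1-θ₁-θ₂)`,
`t₁ = 1 - yθ₁`, `t₂ = 1 - yθ₂`, `ζ = (t₀t₁t₂)^(1/3)`, `a(z) = 3 z^(3x-1)(1-z)^(3s-1)`: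
`a(vζ) y^(3s-1) (1-ζ)^(-3s) (θ₀θ₁θ₂)^(s-1) / (3ζ²) · y · S_F → a(v) · 3^(3s-1) (θ₀θ₁θ₂)^(s-1)`
as `y → 0⁺`, because `y^(3s-1)(1-ζ)^(-3s) y = (y/(1-ζ))^(3s)` for `0 < y < 1` and `y/(1-ζ) → 3`
(`ζ'(0) = -1/3`), while `ζ → 1`, `a(vζ) → a(v)`, `S_F → 1`. -/
theorem cornerFaceLimitThree : ∀ (x s : ℚ), 0 < x → 0 < s → ∀ (th1 th2 v : ℝ), 0 < th1 → 0 < th2 → th1 + th2 < 1 → 0 < v → v < 1 → Filter.Tendsto (fun y : ℝ => ((3 * (v * ((1 - y * (1 - th1 - th2)) * (1 - y * th1) * (1 - y * th2)) ^ ((1:ℝ)/3)) ^ (3 * (x:ℝ) - 1) * (1 - (v * ((1 - y * (1 - th1 - th2)) * (1 - y * th1) * (1 - y * th2)) ^ ((1:ℝ)/3))) ^ (3 * (s:ℝ) - 1)) * y ^ (3 * (s:ℝ) - 1) * (1 - ((1 - y * (1 - th1 - th2)) * (1 - y * th1) * (1 - y * th2)) ^ ((1:ℝ)/3)) ^ (-(3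 * (s:ℝ))) * ((1 - th1 - th2) * th1 * th2) ^ ((s:ℝ) - 1) / (3 * (((1 - y * (1 - th1 - th2)) * (1 - y * th1) * (1 - y * th2)) ^ ((1:ℝ)/3)) ^ 2)) * y * ((1 - th1 - th2) * (1 - y * (1 - th1 - th2)) * ((1 - y * th1) ^ ((1:ℝ)/3) * (1 - y * th2) ^ ((2:ℝ)/3)) + th1 * (1 - y * th1) * ((1 - y * th2) ^ ((1:ℝ)/3) * (1 - y * (1 - th1 - th2)) ^ ((2:ℝ)/3)) + th2 * (1 - y * th2) * ((1 - y * (1 - th1 - th2)) ^ ((1:ℝ)/3) * (1 - y * th1) ^ ((2:ℝ)/3)))) (nhdsWithin 0 (Set.Ioi 0)) (nhds ((3 * (v) ^ (3 * (x:ℝ) - 1) * (1 - (v)) ^ (3 * (s:ℝ) - 1)) * ((3:ℝ) ^ (3 * (s:ℝ) - 1) * ((1 - th1 - th2) * th1 * th2) ^ ((s:ℝ) - 1)))) := by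
  intro x s _ _ th1 th2 v h1 h2 h12 hv0 hv1
  have h0 : 0 < 1 - th1 - th2 := by linarith
  have h0' : 1 - th1 - th2 < 1 := by linarith
  have h1' : th1 < 1 := by linarith
  have h2' : th2 < 1 := by linarith
  have hsum : (1 - th1 - th2) + th1 + th2 = 1 := by ring
  exact tendsto_of_parts (σ := 3 * (s:ℝ)) (K := ((1 - th1 - th2) * th1 * th2) ^ ((s:ℝ) - 1))
    (tendsto_div_one_sub_geomMean (1 - th1 - th2) th1 th2 hsum)
    (tendsto_nhdsWithin_of_tendsto_nhds (tendsto_geomMean (1 - th1 - th2) th1 th2))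
    (tendsto_nhdsWithin_of_tendsto_nhds
      (tendsto_density (1 - th1 - th2) th1 th2 v (3 * (x:ℝ) - 1) (3 * (s:ℝ) - 1) hv0 hv1))
    (tendsto_nhdsWithin_of_tendsto_nhds (tendsto_weight (1 - th1 - th2) th1 th2 hsum))
    (fun y hy0 hy1 => (geomMean_mem hy0 hy1 h0 h0' h1 h1' h2 h2').2)

end Summit.KontsevichZagierPeriods.TerasomaMultiplication.MultiplicationAccessible
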